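import Summits.ABC.ABC.Theses.CubicResolventAllowance
import HarnessLib

/-!
# STUB-IDEAS `stub_complexCubic` · ideator k1 · generation 7 — Cardano recognition of the abc-hard core

Crux stmt-ABC-22740 `CubicResolventAllowance.IndexSzpiro`, stub `stub_complexCubic` (the `d_K < 0` half),
route-ABC-CubicResolventAllowance. FAMILY 1 (recognise & import), gen 7.

Gens 2–6 established (by name, kernel-checked modulo routine helper bodies):
`ABC ⟹ SzpiroConjecture ⟹ Stub ⟹ GenEll.ABCWithExponent 8` — the stub is poly-abc in disguise
(gen 6, `StubIdeas1G6Sketch.lean`, pure-cubic pencil `E_{x,y}` + FLT(3)). Gen 7 RECOGNISES the pencil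
identities as CARDANO'S FORMULA for the 2-division cubic written in `c₄, c₆`:
`432·ψ₂((α + β − b₂)/12) = (α³ − (c₆ + 72m)) + (β³ − (c₆ − 72m)) + 3(α + β)(αβ − c₄)`,
and the class `𝒫 = {Δ ∈ −3·(ℚ×)²} ⊂ 𝒞⁻` (= resolvent field PURE cubic) as the Cardano-rational locus
`(c₆ − 72m)(c₆ + 72m) = c₄³`. Consequences: gen-6 T2 is the special case `b₂ = 0`, `α = 72φ`, `β = −72θ`;
gen-6 T3 (irreducibility, M, minpoly/degree argument) becomes pure algebra (H2/H3 below: a rational root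
DESCENDS to a rational Cardano pair), no `AdjoinRoot`, no `minpoly`.

Statements with `sorry` bodies are the proposals; H0, H1, H4a are kernel-checked.
-/

set_option linter.dupNamespace false

noncomputable section

namespace Summit.ABC.ABC.Cruxes.IndexSzpiro.StubIdeasComplexCubic1G7

open Polynomial WeierstrassCurve

/-- The stub, verbatim (payload `stub.signature`). -/
def Stub : Prop :=
  ∀ ε : ℝ, 0 < ε → ∃ C : ℝ, ∀ (W : WeierstrassCurve ℚ) [W.IsElliptic] (K : Type) [Field K] [NumberField K],
    Irreducible W.twoTorsionPolynomial.toPoly → Module.finrank ℚ K = 3 →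
    (∃ θ : K, aeval θ W.twoTorsionPolynomial.toPoly = 0) → NumberField.discr K < 0 →
    (W.minimalDiscriminantNorm ℤ : ℝ) ≤ C * |(NumberField.discr K : ℝ)| * (W.conductorNorm ℤ : ℝ) ^ (6 + ε)

/-! ## H0 — the Cardano-rational class `𝒫`: `Δ = −3m²` ⟺ `(c₆ + 72m)(c₆ − 72m) = c₄³` (kernel-checked) -/

/-- H0 (S, kernel-checked). Over any commutative ring, `Δ = −3m²` iff `(c₆ + 72m)(c₆ − 72m) = c₄³`
(Mathlib `WeierstrassCurve.c_relation : 1728Δ = c₄³ − c₆²`; `1728·3 = 72²`). This is the equation of the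
class `𝒫 = {Δ_E ∈ −3(ℚ×)²}` = {resolvent cubic field pure} on which gen 6 located the abc-hardness. [folklore] -/
theorem Δ_eq_neg_three_sq_iff {R : Type} [CommRing R] [IsDomain R] [CharZero R]
    (W : WeierstrassCurve R) (m : R) :
    W.Δ = -3 * m ^ 2 ↔ (W.c₆ + 72 * m) * (W.c₆ - 72 * m) = W.c₄ ^ 3 := by
  constructor
  · intro h
    linear_combination (-1728 : R) * h + W.c_relation
  · intro h
    have h1728 : (1728 : R) * (W.Δ + 3 * m ^ 2) = 0 := by
      linear_combination W.c_relation - h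
    have : W.Δ + 3 * m ^ 2 = 0 := by
      rcases mul_eq_zero.mp h1728 with h0 | h0
      · exact absurd h0 (by norm_num)
      · exact h0
    linear_combination this

/-! ## H1 — Cardano's formula for the 2-division cubic (kernel-checked) -/

/-- H1 (S, kernel-checked). CARDANO ROOT. In any field `K` of characteristic `0`: if `α³ = c₆ + 72m`,
`β³ = c₆ − 72m` and `αβ = c₄` then `(α + β − b₂)/12` is a root of `ψ₂ = 4X³ + b₂X² + 2b₄X + b₆`
(`ξ = 12x + b₂` depresses `432ψ₂` to `ξ³ − 3c₄ξ − 2c₆`). Such a pair exists over `ℚ(∛(c₆ + 72m))` exactly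
when `Δ = −3m²` (H0), i.e. on `𝒫`; gen-6 `pencil_root` is the case `b₂ = 0`, `α = 72φ`, `β = −72θ`. [folklore] -/
theorem cardano_root {K : Type} [Field K] [CharZero K] [Algebra ℚ K] (W : WeierstrassCurve ℚ) (m : ℚ)
    (α β : K)
    (hα : α ^ 3 = algebraMap ℚ K (W.c₆ + 72 * m)) (hβ : β ^ 3 = algebraMap ℚ K (W.c₆ - 72 * m))
    (hαβ : α * β = algebraMap ℚ K W.c₄) :
    aeval ((α + β - algebraMap ℚ K W.b₂) / 12) W.twoTorsionPolynomial.toPoly = 0 := by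
  simp only [WeierstrassCurve.twoTorsionPolynomial, Cubic.toPoly, map_add, map_mul, map_pow, map_ofNat,
    aeval_X, aeval_C]
  simp only [WeierstrassCurve.c₄, WeierstrassCurve.c₆, map_add, map_sub, map_mul, map_pow, map_neg,
    map_ofNat] at hα hβ hαβ
  linear_combination (1 / 432 : K) * (hα + hβ + 3 * (α + β) * hαβ)

/-! ## H2 — Cardano DESCENT: a rational root yields a rational Cardano pair (M) -/

/-- H2 (M). If `Δ = −3m² ≠ 0` and `ψ₂` has a rational root `x₀`, then there are `a, b ∈ ℚ` with `a³ = c₆ + 72m`,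
`b³ = c₆ − 72m`, `ab = c₄`. WITNESS: `s := 12x₀ + b₂` satisfies `s³ − 3c₄s − 2c₆ = 432ψ₂(x₀) = 0`;
`s² ≠ c₄` (else `c₆ = −s³`, `c₆² = c₄³`, `Δ = 0`); `d := 144m/(s² − c₄)`; then `d² = s² − 4c₄` (expand with
`c_relation` and `2c₆ = s³ − 3c₄s`), and `a := (s + d)/2`, `b := (s − d)/2` work (`ab = (s² − d²)/4 = c₄`,
`a³ + b³ = s³ − 3c₄s = 2c₆`, `a³ − b³ = d(s² − c₄) = 144m`). Tools: `field_simp`, `linear_combination`. [folklore] -/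
theorem exists_cardano_pair_of_isRoot (W : WeierstrassCurve ℚ) {m x₀ : ℚ} (hm : m ≠ 0)
    (hΔ : W.Δ = -3 * m ^ 2) (hx : W.twoTorsionPolynomial.toPoly.IsRoot x₀) :
    ∃ a b : ℚ, a ^ 3 = W.c₆ + 72 * m ∧ b ^ 3 = W.c₆ - 72 * m ∧ a * b = W.c₄ := by
  sorry

/-! ## H3 — irreducibility on `𝒫` ⟺ no rational Cardano pair (S from H1 + H2) -/

/-- H3 (S). On `𝒫` (`Δ = −3m²`, `m ≠ 0`): `ψ₂` is irreducible over `ℚ` iff there is NO rational Cardano pair.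
(→) a pair gives the rational root of H1 (`K = ℚ`), contradicting irreducibility of a cubic
(`Polynomial.irreducible_iff_roots_eq_zero_of_degree_le_three`, `natDegree = 3` by `Cubic.natDegree_of_a_ne_zero`);
(←) Mathlib `Polynomial.irreducible_of_degree_le_three_of_not_isRoot` + H2. NOTE the pair condition is needed as
stated: for `c₄ = 0` (`j = 0`, `y² = x³ + b`, `m = ±12b`) one of `c₆ ± 72m` vanishes (a cube) while `ψ₂ = 4(X³ + b)`
is irreducible unless `−b ∈ ℚ³`; when `c₆ + 72m ≠ 0` the condition is simply "`c₆ + 72m` is a rational cube". [folklore] -/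
theorem irreducible_iff_no_cardano_pair (W : WeierstrassCurve ℚ) {m : ℚ} (hm : m ≠ 0)
    (hΔ : W.Δ = -3 * m ^ 2) :
    Irreducible W.twoTorsionPolynomial.toPoly ↔
      ¬ ∃ a b : ℚ, a ^ 3 = W.c₆ + 72 * m ∧ b ^ 3 = W.c₆ - 72 * m ∧ a * b = W.c₄ := by
  sorry

/-! ## H4 — the gen-6 pencil through Cardano: `c₆`, the Cardano pair `(−72³xy², 72³x²y)`, and T3 as a corollary -/

/-- Gen-6 pencil, verbatim (`StubIdeas1G6Sketch.pencilInt`): `E_{x,y} : Y² = X³ + 108xy·X + 216xy(y − x)`. -/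
def pencilInt (x y : ℤ) : WeierstrassCurve ℤ := ⟨0, 0, 0, 108 * x * y, 216 * x * y * (y - x)⟩

/-- `E_{x,y}` over `ℚ`. -/
abbrev pencil (x y : ℤ) : WeierstrassCurve ℚ := (pencilInt x y).baseChange ℚ

/-- H4a (kernel-checked). `c₆(E_{x,y}) = −2⁸3⁶·xy(y − x)`; with `m = −2⁵3⁴·xyz` (`z = x + y`, `Δ = −3m²` by gen-6
T1b) the Cardano pair of targets is `c₆ + 72m = −72³·xy²`, `c₆ − 72m = 72³·x²y`, product `(−72²xy)³ = c₄³`. [folklore] -/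
theorem pencilInt_c₆ (x y : ℤ) : (pencilInt x y).c₆ = -(2 ^ 8 * 3 ^ 6) * (x * y * (y - x)) := by
  simp only [pencilInt, WeierstrassCurve.c₆, WeierstrassCurve.b₂, WeierstrassCurve.b₄, WeierstrassCurve.b₆]
  ring

/-- H4b (kernel-checked). The Cardano targets of the pencil: `c₆ + 72m = −72³xy²` and `c₆ − 72m = 72³x²y`
for `m = −2⁵3⁴xy(x+y)`. [folklore] -/
theorem pencilInt_cardano_targets (x y : ℤ) :
    (pencilInt x y).c₆ + 72 * (-(2 ^ 5 * 3 ^ 4) * (x * y * (x + y))) = -(72 ^ 3) * (x * y ^ 2) ∧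
    (pencilInt x y).c₆ - 72 * (-(2 ^ 5 * 3 ^ 4) * (x * y * (x + y))) = 72 ^ 3 * (x ^ 2 * y) := by
  rw [pencilInt_c₆]
  constructor <;> ring

/-- H4 (S from H3 + H4a/b + gen-6 T1b; = gen-6 T3 `pencil_irreducible`, now WITHOUT any field-degree argument).
For `xy(x + y) ≠ 0` and `xy²` not a rational cube, `ψ₂(E_{x,y})` is irreducible: a rational Cardano pair would give
`a³ = −72³xy²`, i.e. `(−a/72)³ = xy²`. [folklore] -/
theorem pencil_irreducible {x y : ℤ} (hx : x ≠ 0) (hy : y ≠ 0) (hz : x + y ≠ 0)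
    (hcube : ∀ r : ℚ, r ^ 3 ≠ (x : ℚ) * y ^ 2) :
    Irreducible (pencil x y).twoTorsionPolynomial.toPoly := by
  sorry

/-! ## H5 — the recognition, by name (kernel-checked plumbing only) -/

/-- H5 (kernel-checked). The route crux gives the stub (drop the sign hypothesis). [folklore] -/
theorem stub_of_indexSzpiro (h : Summit.ABC.ABC.Theses.CubicResolventAllowance.IndexSzpiro) : Stub := by
  intro ε hε
  obtain ⟨C, hC⟩ := h ε hε
  exact ⟨C, fun W _ K _ _ hirr h3 hθ _ => hC W K hirr h3 hθ⟩

end Summit.ABC.ABC.Cruxes.IndexSzpiro.StubIdeasComplexCubic1G7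

end
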